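import Mathlib
import Summits.CriticalPhenomena.Ising3DConformalLimit.Theorems.PrecisionLaplacianEtaBoundsTransferTransfer
import Summits.CriticalPhenomena.Ising3DConformalLimit.Theorems.PrecisionLaplacianEtaBoundsTransferShell
import Summits.CriticalPhenomena.Ising3DConformalLimit.Theorems.PrecisionLaplacianTwoPointSpineGlueGreen
import Summits.CriticalPhenomena.Ising3DConformalLimit.Theorems.PrecisionLaplacianTwoPointSpineGlueSymbol
import Literature.Probability.LatticeModels.IsingExponents
import HarnessLib

/-!
# TwoPointSpineGlue (route PrecisionLaplacian, item stmt-CriticalPhenomena-4805) — two-sided `η`-bounds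
# from heavy boxes and an upper envelope

Helper file 7.  The `EtaBoundsTransfer` pipeline (item 4804: symmetric potential + two-sided pointwise
tail bounds on the direct correlation function `a` ⇒ `HasIsingEtaBounds 3 η`) is re-run under the weaker
input available in `TwoPointSpineGlue`: the symmetric-potential hypothesis for `G = criticalTwoPoint 3`,
HEAVY BOXES for `a` (for every scale `L ≥ L₀` a box `c_L + Λ_L`, avoiding the origin, on which
`a ≥ c L^{-(5-η)}`) and an upper envelope `a(x) ≤ C‖x‖_∞^{-(5-η)}`:

* `green_package_full_of_pos` — the full Green package (equation, no killing, convolution powers and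
  the Green representation `G = A₀⁻¹ ∑ P n`) under positivity of ONE coefficient `a(y₀) > 0`
  (`…TwoPointSpineGlueGreen`);
* `block_sum_upper_of_symbol` — the block-sum upper bound `∑_{y,y'∈Λ_m} G(y−y') ≤ K₁(2m+1)^{5−η}`
  from a SYMBOL lower bound `1 − q̂(k) ≥ c₁‖k‖^{2−η}` (instead of the pointwise lower tail bound);
* `hasIsingEtaBounds_of_heavyBoxes` — **`c‖x‖^{-(1+η)} ≤ ⟨σ₀σ_x⟩_{β_c} ≤ C‖x‖^{-(1+η)}`** under the
  symmetric-potential hypothesis, heavy boxes and the upper envelope (symbol bound by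
  `…TwoPointSpineGlueSymbol.psi_lower_of_boxes`; ball sums from below by the quadratic test function;
  Messager–Miracle-Solé transfer — all from the `EtaBoundsTransfer` helper files).

No definitions are introduced.
-/

noncomputable section

namespace Summit.CriticalPhenomena.Ising3DConformalLimit.Theorems.SpineGlue

open Finset Real Filter Topology MeasureTheory Literature.Probability.LatticeModels
open Summit.CriticalPhenomena.Ising3DConformalLimit.Theorems.EtaBoundsTransfer
open scoped BigOperators ENNReal

/-! ### The full Green package under positivity of one coefficient -/

/-- **The full Green package under `a(y₀) > 0`.** Under the symmetric-potential hypothesis for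
`G = criticalTwoPoint 3` and positivity of the direct correlation function at one site `y₀ ≠ 0`: there
are `A₀ > 0`, the even step weights `b = 𝟙_{≠0} a` with `∑ b = A₀`, the infinite-volume equation
`A₀G − b∗G = δ`, and nonnegative summable convolution powers `P n` of `q = b/A₀` with
`G = A₀⁻¹ ∑_n P n`. -/
theorem green_package_full_of_pos
    (hSP : ∀ A : Finset (Site 3), (Matrix.of fun (p q : ↥A) => criticalTwoPoint 3 (q.1 - p.1)).PosDef ∧
      ∀ u v : ↥A, (u ≠ v → (Matrix.of fun (p q : ↥A) => criticalTwoPoint 3 (q.1 - p.1))⁻¹ u v ≤ 0) ∧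
        0 ≤ ∑ w, (Matrix.of fun (p q : ↥A) => criticalTwoPoint 3 (q.1 - p.1))⁻¹ u w)
    {y₀ : Site 3} (hy₀0 : y₀ ≠ 0)
    (hy₀ : 0 < ⨅ A : {A : Finset (Site 3) // (0 : Site 3) ∈ A ∧ y₀ ∈ A},
        -((Matrix.of fun (p q : ↥A.1) => criticalTwoPoint 3 (q.1 - p.1))⁻¹ ⟨0, A.2.1⟩ ⟨y₀, A.2.2⟩)) :
    ∃ (A₀ : ℝ) (b : Site 3 → ℝ) (P : ℕ → Site 3 → ℝ),
      0 < A₀ ∧ (∀ y, 0 ≤ b y) ∧ Summable b ∧ (∀ y, b (-y) = b y) ∧ ∑' y, b y = A₀ ∧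
      (∀ y, y ≠ 0 → b y = ⨅ A : {A : Finset (Site 3) // (0 : Site 3) ∈ A ∧ y ∈ A},
        -((Matrix.of fun (p q : ↥A.1) => criticalTwoPoint 3 (q.1 - p.1))⁻¹ ⟨0, A.2.1⟩ ⟨y, A.2.2⟩)) ∧
      (∀ z, A₀ * criticalTwoPoint 3 z - ∑' y, b y * criticalTwoPoint 3 (z - y) = if z = 0 then 1 else 0) ∧
      (∀ z, P 0 z = if z = 0 then 1 else 0) ∧
      (∀ n z, P (n + 1) z = ∑' y, (b y / A₀) * P n (z - y)) ∧
      (∀ n z, 0 ≤ P n z) ∧ (∀ n, Summable (P n)) ∧ (∀ z, Summable fun n => P n z) ∧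
      (∀ z, criticalTwoPoint 3 z = A₀⁻¹ * ∑' n, P n z) ∧
      (∀ z, 0 ≤ criticalTwoPoint 3 z) ∧ (∀ z, criticalTwoPoint 3 z ≤ criticalTwoPoint 3 0) := by
  haveI := infinite_site_three
  set G : Site 3 → ℝ := criticalTwoPoint 3 with hG
  set M : (A : Finset (Site 3)) → Matrix A A ℝ := fun A => Matrix.of fun (p q : ↥A) => G (q.1 - p.1)
    with hMdef
  have hM : ∀ A, M A = Matrix.of fun (p q : ↥A) => G (q.1 - p.1) := fun A => rfl
  have hSP' : ∀ A : Finset (Site 3), (M A).PosDef ∧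
      ∀ u v : ↥A, (u ≠ v → (M A)⁻¹ u v ≤ 0) ∧ 0 ≤ ∑ w, (M A)⁻¹ u w := hSP
  set a : Site 3 → ℝ := fun y => ⨅ A : {A : Finset (Site 3) // (0 : Site 3) ∈ A ∧ y ∈ A},
    -((M A.1)⁻¹ ⟨0, A.2.1⟩ ⟨y, A.2.2⟩) with hadef
  have ha : ∀ y, a y = ⨅ A : {A : Finset (Site 3) // (0 : Site 3) ∈ A ∧ y ∈ A},
      -((M A.1)⁻¹ ⟨0, A.2.1⟩ ⟨y, A.2.2⟩) := fun y => rfl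
  have hay₀ : 0 < a y₀ := hy₀
  set k : ℕ → ℝ := fun n => (M (box 3 n))⁻¹ ⟨0, zero_mem_box 3 n⟩ ⟨0, zero_mem_box 3 n⟩ with hkdef
  have hk : ∀ n, k n = (M (box 3 n))⁻¹ ⟨0, zero_mem_box 3 n⟩ ⟨0, zero_mem_box 3 n⟩ := fun n => rfl
  set t : ℕ → Site 3 → ℝ := fun n y => if hy : y ∈ box 3 n then
    -(M (box 3 n))⁻¹ ⟨0, zero_mem_box 3 n⟩ ⟨y, hy⟩ else 0 with htdef
  have ht : ∀ n y (hy : y ∈ box 3 n), t n y = -(M (box 3 n))⁻¹ ⟨0, zero_mem_box 3 n⟩ ⟨y, hy⟩ := by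
    intro n y hy; simp only [htdef, dif_pos hy]
  -- facts about `G`
  have hGto : Tendsto G cofinite (𝓝 0) := criticalTwoPoint_tendsto_zero_cofinite
  have hGns : ¬ Summable G := criticalTwoPoint_not_summable
  have hGnn : ∀ x, 0 ≤ G x := apply_nonneg hM hSP'
  have hGle : ∀ x, G x ≤ G 0 := fun x => by
    by_cases hx : x = 0
    · rw [hx]
    · exact (apply_lt_apply_zero hM hSP' hx).le
  -- the potential-theory chain
  obtain ⟨A₀, hkA, hkle, hA0⟩ := exists_A0 hM hSP' hGto hk
  obtain ⟨hsa, hsa_le⟩ := summable_a hSP' hk ht ha hkle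
  have heq := limit_equation hM hSP' hGto hk ht ha hkA hkle
  set b : Site 3 → ℝ := fun y => if y = 0 then 0 else a y with hbdef
  have hb0 : ∀ y, 0 ≤ b y := fun y => by
    simp only [hbdef]; split_ifs with h
    · exact le_rfl
    · exact a_nonneg hSP' ha h
  have hbev : ∀ y, b (-y) = b y := fun y => by
    by_cases hy : y = 0
    · simp [hbdef, hy]
    · simp only [hbdef, if_neg hy, if_neg (neg_ne_zero.2 hy)]
      exact a_neg hM hSP' ht ha hy
  have hby₀ : 0 < b y₀ := by simp only [hbdef, if_neg hy₀0]; exact hay₀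
  have hinj := nsmul_injective_of_ne_zero hy₀0
  -- convolution powers in `ℝ≥0∞`
  set Q : ℕ → Site 3 → ℝ≥0∞ := fun n => Nat.rec (fun z => if z = 0 then 1 else 0)
    (fun _ Qn z => ∑' y, ENNReal.ofReal (b y / A₀) * Qn (z - y)) n with hQdef
  have hQ0 : ∀ z, Q 0 z = if z = 0 then 1 else 0 := fun z => rfl
  have hQs : ∀ n z, Q (n + 1) z = ∑' y, ENNReal.ofReal (b y / A₀) * Q n (z - y) := fun n z => rfl
  have hbA : ∑' y, b y = A₀ :=
    tsum_b_eq_of_pos hGnn hGle hGto hGns hb0 hby₀ hinj hsa hA0 hsa_le heq hQ0 hQs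
  have hrepr := green_repr_of_pos hGnn hGle hGto hb0 hby₀ hinj hsa hA0 hsa_le heq hQ0 hQs
  have hQle1 : ∀ n z, Q n z ≤ 1 := Q_le_one hb0 hsa hA0 hsa_le hQ0 hQs
  have hQfin : ∀ n z, Q n z ≠ ∞ := fun n z => ne_top_of_le_ne_top ENNReal.one_ne_top (hQle1 n z)
  -- the real convolution powers
  set P : ℕ → Site 3 → ℝ := fun n z => (Q n z).toReal with hPdef
  have hq0 : ∀ y, 0 ≤ b y / A₀ := fun y => div_nonneg (hb0 y) hA0.le
  refine ⟨A₀, b, P, hA0, hb0, hsa, hbev, hbA, ?_, heq, ?_, ?_, ?_, ?_, ?_, ?_, hGnn, hGle⟩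
  · intro y hy; simp only [hbdef, if_neg hy]; exact ha y
  · intro z; simp only [hPdef, hQ0]; split_ifs <;> simp
  · intro n z
    simp only [hPdef]
    rw [hQs, ENNReal.tsum_toReal_eq (fun y => ENNReal.mul_ne_top ENNReal.ofReal_ne_top (hQfin n _))]
    refine tsum_congr fun y => ?_
    rw [ENNReal.toReal_mul, ENNReal.toReal_ofReal (hq0 y)]
  · intro n z; exact ENNReal.toReal_nonneg
  · intro n
    have h := tsum_Q_eq_pow hb0 hsa hA0 hQ0 hQs n
    refine ENNReal.summable_toReal ?_
    rw [h]
    exact ENNReal.pow_ne_top ENNReal.ofReal_ne_top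
  · intro z
    exact ENNReal.summable_toReal (tsum_Q_ne_top hGnn hGle hb0 hsa hA0 heq hQ0 hQs z)
  · intro z
    have h := hrepr z
    have hfin := tsum_Q_ne_top hGnn hGle hb0 hsa hA0 heq hQ0 hQs z
    have h2 : G z = ((ENNReal.ofReal A₀)⁻¹ * ∑' n, Q n z).toReal := by
      rw [← h, ENNReal.toReal_ofReal (hGnn z)]
    rw [h2, ENNReal.toReal_mul, ENNReal.toReal_inv, ENNReal.toReal_ofReal hA0.le,
      ENNReal.tsum_toReal_eq (fun n => hQfin n z)]

/-! ### Block sums from a symbol lower bound -/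

/-- **Block-sum upper bound from a symbol lower bound**: if `1 − q̂(k) ≥ c₁‖k‖^{2−η}` on the
punctured Brillouin zone (`q = b/A₀`), then `∑_{y,y' ∈ Λ_m} G(y − y') ≤ K₁ (2m+1)^{5−η}`
(Parseval for the convolution powers against the box weight and the Brillouin-zone integral bound,
`…EtaBoundsTransferFourier/Integral`). -/
theorem block_sum_upper_of_symbol {η c₁ : ℝ} (hη0 : 0 < η) (hη1 : η < 1) (hc₁0 : 0 < c₁)
    {A₀ : ℝ} {b : Site 3 → ℝ} {P : ℕ → Site 3 → ℝ}
    (hA0 : 0 < A₀) (hb0 : ∀ y, 0 ≤ b y) (hbs : Summable b) (hbev : ∀ y, b (-y) = b y)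
    (hbA : ∑' y, b y = A₀)
    (hlow : ∀ k : Fin 3 → ℝ, ‖k‖ ≤ π → k ≠ 0 →
      c₁ * ‖k‖ ^ (2 - η) ≤ 1 - ∑' y, b y / A₀ * Real.cos (phase 3 k y))
    (hP0 : ∀ z, P 0 z = if z = 0 then 1 else 0)
    (hPs : ∀ n z, P (n + 1) z = ∑' y, (b y / A₀) * P n (z - y))
    (hPnn : ∀ n z, 0 ≤ P n z) (hPsum : ∀ n, Summable (P n)) (hPn : ∀ z, Summable fun n => P n z)
    (hG : ∀ z, criticalTwoPoint 3 z = A₀⁻¹ * ∑' n, P n z) :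
    ∃ K₁ : ℝ, 0 < K₁ ∧ ∀ m : ℕ, ∑ y ∈ box 3 m, ∑ y' ∈ box 3 m, criticalTwoPoint 3 (y - y')
      ≤ K₁ * (2 * m + 1 : ℝ) ^ (5 - η) := by
  set α : ℝ := 2 - η with hα
  have hα0 : 0 < α := by rw [hα]; linarith
  have hα3 : α < (3 : ℕ) := by rw [hα]; push_cast; linarith
  have hπ := Real.pi_pos
  have _hη := hη0
  -- the step law `q = b / A₀`
  have hq0 : ∀ y, 0 ≤ b y / A₀ := fun y => div_nonneg (hb0 y) hA0.le
  have hqs : Summable (fun y => b y / A₀) := hbs.div_const A₀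
  have hq1' : ∑' y, b y / A₀ = 1 := by rw [tsum_div_const, hbA, div_self hA0.ne']
  have hq1 : ∑' y, b y / A₀ ≤ 1 := hq1'.le
  have hqev : ∀ y, b (-y) / A₀ = b y / A₀ := fun y => by rw [hbev]
  -- the integral constant
  set Cint : ℝ := (2 * π ^ (1 - α / (3 : ℕ)) * (1 / (1 - α / (3 : ℕ)) + 1 / (1 + α / (3 : ℕ)))) ^ (3 : ℕ)
    with hCint
  have hs1 : α / (3 : ℕ) < 1 := by rw [div_lt_one (by norm_num)]; exact hα3
  have hCint0 : 0 < Cint := by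
    have : 0 < 1 - α / (3 : ℕ) := by linarith
    positivity
  refine ⟨A₀⁻¹ * (2 / c₁ / (2 * π) ^ (3 : ℕ) * Cint), by positivity, fun m => ?_⟩
  obtain ⟨hI, hIle⟩ := integral_cube_weight_le (d := 3) (by norm_num) hα0 hα3 m
  have hbs_le := block_sum_green_le (d := 3) (by norm_num) hq0 hqs hq1 hqev hP0 hPs hPnn hPsum hPn
    hc₁0 hlow m hI
  have hGsum : ∑ y ∈ box 3 m, ∑ y' ∈ box 3 m, criticalTwoPoint 3 (y - y')
      = A₀⁻¹ * ∑ y ∈ box 3 m, ∑ y' ∈ box 3 m, ∑' n, P n (y - y') := by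
    rw [Finset.mul_sum]
    refine Finset.sum_congr rfl fun y _ => ?_
    rw [Finset.mul_sum]
    refine Finset.sum_congr rfl fun y' _ => ?_
    exact hG _
  rw [hGsum, show (5 - η) = ((3 : ℕ) : ℝ) + α by rw [hα]; push_cast; ring]
  rw [mul_assoc]
  refine mul_le_mul_of_nonneg_left ?_ (inv_nonneg.2 hA0.le)
  calc ∑ y ∈ box 3 m, ∑ y' ∈ box 3 m, ∑' n, P n (y - y')
      ≤ 2 / c₁ / (2 * π) ^ (3 : ℕ) * ∫ k in Set.pi Set.univ (fun _ : Fin 3 => Set.Icc (-π) π),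
          ‖k‖ ^ (-α) * ∑ y ∈ box 3 m, ∑ y' ∈ box 3 m, Real.cos (phase 3 k (y - y')) := hbs_le
    _ ≤ 2 / c₁ / (2 * π) ^ (3 : ℕ) * (Cint * (2 * m + 1 : ℝ) ^ (((3 : ℕ) : ℝ) + α)) :=
        mul_le_mul_of_nonneg_left hIle (by positivity)
    _ = 2 / c₁ / (2 * π) ^ (3 : ℕ) * Cint * (2 * m + 1 : ℝ) ^ (((3 : ℕ) : ℝ) + α) := by ring

/-! ### Two-sided `η`-bounds from heavy boxes and an upper envelope -/

/-- **`HasIsingEtaBounds 3 η` from heavy boxes.**  Under the symmetric-potential hypothesis for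
`G = criticalTwoPoint 3`, `0 < η < 1`, heavy boxes for the direct correlation function `a` (for every
`L ≥ L₀` a box `c_L + Λ_L` avoiding the origin with `a ≥ c L^{-(5−η)}` on it) and an upper envelope
`a(x) ≤ C‖x‖^{-(5−η)}` off the origin, the critical two-point function obeys
`c'‖x‖^{-(1+η)} ≤ ⟨σ₀σ_x⟩_{β_c} ≤ C'‖x‖^{-(1+η)}`. -/
theorem hasIsingEtaBounds_of_heavyBoxes
    (hSP : ∀ A : Finset (Site 3), (Matrix.of fun (p q : ↥A) => criticalTwoPoint 3 (q.1 - p.1)).PosDef ∧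
      ∀ u v : ↥A, (u ≠ v → (Matrix.of fun (p q : ↥A) => criticalTwoPoint 3 (q.1 - p.1))⁻¹ u v ≤ 0) ∧
        0 ≤ ∑ w, (Matrix.of fun (p q : ↥A) => criticalTwoPoint 3 (q.1 - p.1))⁻¹ u w)
    {η : ℝ} (hη0 : 0 < η) (hη1 : η < 1)
    {c C : ℝ} (hc : 0 < c) {L₀ : ℕ} (hL₀ : 1 ≤ L₀) (ctr : ℕ → Site 3)
    (hlow : ∀ L : ℕ, L₀ ≤ L → ∀ u ∈ box 3 L, ctr L + u ≠ 0 ∧ c * (L : ℝ) ^ (-(5 - η)) ≤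
      (⨅ A : {A : Finset (Site 3) // (0 : Site 3) ∈ A ∧ ctr L + u ∈ A},
        -((Matrix.of fun (p q : ↥A.1) => criticalTwoPoint 3 (q.1 - p.1))⁻¹ ⟨0, A.2.1⟩ ⟨ctr L + u, A.2.2⟩)))
    (hup : ∀ x : Site 3, x ≠ 0 →
      (⨅ A : {A : Finset (Site 3) // (0 : Site 3) ∈ A ∧ x ∈ A},
        -((Matrix.of fun (p q : ↥A.1) => criticalTwoPoint 3 (q.1 - p.1))⁻¹ ⟨0, A.2.1⟩ ⟨x, A.2.2⟩))
        ≤ C * ‖x‖ ^ (-(5 - η))) :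
    HasIsingEtaBounds 3 η := by
  set a : Site 3 → ℝ := fun y => ⨅ A : {A : Finset (Site 3) // (0 : Site 3) ∈ A ∧ y ∈ A},
    -((Matrix.of fun (p q : ↥A.1) => criticalTwoPoint 3 (q.1 - p.1))⁻¹ ⟨0, A.2.1⟩ ⟨y, A.2.2⟩) with hadef
  have hlow' : ∀ L : ℕ, L₀ ≤ L → ∀ u ∈ box 3 L, ctr L + u ≠ 0 ∧ c * (L : ℝ) ^ (-(5 - η)) ≤ a (ctr L + u) :=
    hlow
  have hup' : ∀ x : Site 3, x ≠ 0 → a x ≤ C * ‖x‖ ^ (-(5 - η)) := hup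
  -- a site with `a > 0`
  have hL₀pos : (0 : ℝ) < L₀ := by exact_mod_cast hL₀
  obtain ⟨hy₀0, hy₀⟩ := hlow' L₀ le_rfl 0 (zero_mem_box 3 L₀)
  have hay₀ : 0 < a (ctr L₀ + 0) := lt_of_lt_of_le (mul_pos hc (Real.rpow_pos_of_pos hL₀pos _)) hy₀
  -- the Green package
  obtain ⟨A₀, b, P, hA0, hb0, hbs, hbev, hbA, hba, heq, hP0, hPs, hPnn, hPsum, hPn, hG, hGnn, hGle⟩ :=
    green_package_full_of_pos hSP hy₀0 hay₀
  -- heavy boxes and envelope for `b`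
  set α : ℝ := 2 - η with hα
  have hα0 : 0 < α := by rw [hα]; linarith
  have hα1 : 1 < α := by rw [hα]; linarith
  have hα2 : α < 2 := by rw [hα]; linarith
  have hexp : -(5 - η) = -(((3 : ℕ) : ℝ) + α) := by rw [hα]; push_cast; ring
  have hblow : ∀ L : ℕ, L₀ ≤ L → ∀ u ∈ box 3 L, c * (L : ℝ) ^ (-(((3 : ℕ) : ℝ) + α)) ≤ b (ctr L + u) := by
    intro L hL u hu
    obtain ⟨h0, h1⟩ := hlow' L hL u hu
    rw [hba _ h0, ← hexp]
    exact h1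
  have hbup : ∀ y : Site 3, y ≠ 0 → b y ≤ C * ‖y‖ ^ (-(((3 : ℕ) : ℝ) + α)) := by
    intro y hy
    rw [hba _ hy, ← hexp]
    exact hup' y hy
  -- `C > 0`: test the envelope at the positive site
  have hCpos : 0 < C := by
    have h1 := hbup _ hy₀0
    rw [hba _ hy₀0] at h1
    have h2 : 0 < C * ‖ctr L₀ + 0‖ ^ (-(((3 : ℕ) : ℝ) + α)) := lt_of_lt_of_le hay₀ h1
    have h3 : 0 < ‖ctr L₀ + 0‖ ^ (-(((3 : ℕ) : ℝ) + α)) := Real.rpow_pos_of_pos (norm_pos_iff.2 hy₀0) _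
    exact pos_of_mul_pos_left h2 h3.le
  -- the symbol lower bound from the heavy boxes
  obtain ⟨c₁, hc₁0, hψ⟩ := psi_lower_of_boxes (d := 3) (by norm_num) hc hα0 hb0 hbs hL₀ ctr hblow
  have hqs : Summable (fun y => b y / A₀) := hbs.div_const A₀
  have hq0 : ∀ y, 0 ≤ b y / A₀ := fun y => div_nonneg (hb0 y) hA0.le
  have hq1' : ∑' y, b y / A₀ = 1 := by rw [tsum_div_const, hbA, div_self hA0.ne']
  have hlow_symbol : ∀ k : Fin 3 → ℝ, ‖k‖ ≤ π → k ≠ 0 →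
      c₁ / A₀ * ‖k‖ ^ (2 - η) ≤ 1 - ∑' y, b y / A₀ * Real.cos (phase 3 k y) := by
    intro k hk hk0
    have hsc : Summable fun y => b y / A₀ * Real.cos (phase 3 k y) :=
      Summable.of_norm_bounded hqs fun y => by
        rw [Real.norm_eq_abs, abs_mul, abs_of_nonneg (hq0 y)]
        exact mul_le_of_le_one_right (hq0 y) (Real.abs_cos_le_one _)
    have h1 : 1 - ∑' y, b y / A₀ * Real.cos (phase 3 k y)
        = A₀⁻¹ * ∑' y, b y * (1 - Real.cos (phase 3 k y)) := by
      calc 1 - ∑' y, b y / A₀ * Real.cos (phase 3 k y)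
          = ∑' y, b y / A₀ - ∑' y, b y / A₀ * Real.cos (phase 3 k y) := by rw [hq1']
        _ = ∑' y, (b y / A₀ - b y / A₀ * Real.cos (phase 3 k y)) := (Summable.tsum_sub hqs hsc).symm
        _ = A₀⁻¹ * ∑' y, b y * (1 - Real.cos (phase 3 k y)) := by
            rw [← tsum_mul_left]
            refine tsum_congr fun y => ?_
            rw [div_eq_mul_inv]
            ring
    rw [h1, ← hα]
    calc c₁ / A₀ * ‖k‖ ^ α = A₀⁻¹ * (c₁ * ‖k‖ ^ α) := by rw [div_eq_mul_inv]; ring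
      _ ≤ A₀⁻¹ * ∑' y, b y * (1 - Real.cos (phase 3 k y)) :=
          mul_le_mul_of_nonneg_left (hψ k hk hk0) (inv_nonneg.2 hA0.le)
  -- block sums and the pointwise upper bound
  obtain ⟨K₁, hK₁, hblock⟩ := block_sum_upper_of_symbol hη0 hη1 (div_pos hc₁0 hA0) hA0 hb0 hbs hbev hbA
    hlow_symbol hP0 hPs hPnn hPsum hPn hG
  obtain ⟨C', hC'⟩ := pointwise_upper hη0 hη1 hK₁ hblock hGle
  -- box sums from below and above, and the pointwise lower bound
  have hbsl : ∀ R : ℕ, 1 ≤ R → (R : ℝ) ^ (2 - η) /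
      (C * (2 * (3 : ℕ) * 3 ^ ((3 : ℕ) - 1)) * (((3 : ℕ) : ℝ) * (1 + 1 / (2 - (2 - η))) + 1 / (2 - η)))
        ≤ ∑ u ∈ box 3 R, criticalTwoPoint 3 u :=
    fun R hR => box_sum_lower (d := 3) (by norm_num) hGnn hGle hb0 hbs hbev hbA heq hCpos hα1 hα2 hbup hR
  have hbsu : ∀ L : ℕ, 1 ≤ L → ∑ u ∈ box 3 L, criticalTwoPoint 3 u ≤ 8 * K₁ * 5 ^ (2 - η) * (L : ℝ) ^ (2 - η) :=
    fun L hL => box_sum_upper hη1 hK₁ hblock hGnn hL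
  have hCs : 0 < C * (2 * (3 : ℕ) * 3 ^ ((3 : ℕ) - 1)) * (((3 : ℕ) : ℝ) * (1 + 1 / (2 - (2 - η))) + 1 / (2 - η)) := by
    have : (0 : ℝ) < 2 - (2 - η) := by linarith
    have : (0 : ℝ) < 2 - η := by linarith
    positivity
  have hK₂ : 0 < 8 * K₁ * (5 : ℝ) ^ (2 - η) := by positivity
  obtain ⟨c', hc', hlow⟩ := pointwise_lower hη0 hη1 hCs hK₂ hbsl hbsu hGnn
  -- assemble `HasIsingEtaBounds 3 η`
  show ∃ c'' C'' : ℝ, 0 < c'' ∧ ∀ x, x ≠ 0 →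
    c'' * (‖x‖ : ℝ) ^ (-(((3 : ℕ) : ℝ) - 2 + η)) ≤ criticalTwoPoint 3 x ∧
      criticalTwoPoint 3 x ≤ C'' * (‖x‖ : ℝ) ^ (-(((3 : ℕ) : ℝ) - 2 + η))
  have h3 : ((3 : ℕ) : ℝ) = (3 : ℝ) := by norm_num
  rw [h3]
  exact ⟨c', C', hc', fun x hx => ⟨hlow x hx, hC' x hx⟩⟩

end Summit.CriticalPhenomena.Ising3DConformalLimit.Theorems.SpineGlue

end
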